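import Literature.AnabelianGeometry.AbsoluteAnabelian.MonoidKummerMapsTLGLiftForcesContinuity
import Literature.AnabelianGeometry.AbsoluteAnabelian.MonoidKummerMapsMonoAnalyticLiftHolds
import HarnessLib

/-!
# [AbsTopIII] Prop 3.2 (iv) / 3.3 (ii): the lifting sentences hold UNCONDITIONALLY for every pair
# whose Galois augmentation is a QUOTIENT map (print's "the quotient `Π_k ↠ G_k`", Def. 3.1 (i))

Proof-only companion (theorems only, no new definitions) of abc-iut-L4-t2's `MonoidKummerMaps.lean`
(S. Mochizuki, *Topics in Absolute Anabelian Geometry III*, Def. 3.1 (i) p. 66 l. 20–21 "Let `Π_k` be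
a topological group, equipped with a continuous surjection `ε_k : Π_k ↠ G_k`", p. 67 l. 12 "[so the
quotient `Π_k ↠ G_k` may be recovered as the image of …]"; Prop. 3.2 (iv) p. 72, Prop. 3.3 (ii) p. 74;
kurims manuscript, lit key `paper:url-5493eb38cbb7`).

The tree types Def. 3.1 (i) FAITHFULLY as "continuous surjection" (`ModelMLFGaloisData.aug`,
`continuous_aug`, `aug_surjective`) — which admits augmentations that are NOT quotient maps (e.g.
`Gal(k̄/k)` with the discrete topology, `ε = id`; `MonoidKummerMapsTLGLiftForcesContinuity.lean`), and
exactly those force the Nikolov–Segal-type residual F-1977 of F-0412.  This file proves that for pairs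
whose augmentation IS an OPEN (= quotient) map — print's own gloss "the quotient `Π_k ↠ G_k`", and the
case of every pair arising from an étale or tempered fundamental group — the `TLG`/`TCG` lifting sentences
and the schemata F-0409 / F-0413 hold UNCONDITIONALLY ((BA) = `biAnabelianUnits_holds` + this seat's
gen-3 `ModelMLFGaloisData.exists_galoisContinuousMulEquiv_of_isOpenMap`), generalising the σ-compact
case (`MonoidKummerMapsTLGLiftSigmaCompactProofs.lean`, open mapping theorem):

* `ModelMLFGaloisData.isOpenMap_aug_of_tlgPair_iso` — "open augmentation" is a property of the `TLG`
  PAIR, not of the model: it transfers along every isomorphism of model `TLG`-pairs (the abstract Galois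
  isomorphism covered by an isomorphism of pairs is CONTINUOUS — `continuous_galoisMulEquiv_of_equivariant`
  applied to the object component);
* `tlgLifting_openAug_holds`, `tcgLifting_openAug_holds` — the lifting sentences for all MLF-Galois
  `TLG`/`TCG`-pairs admitting a model with open augmentation;
* `galoisIsoLiftsToTMPairIso_of_openAug_holds` (F-0409), `unitPairIsoFibresOfType_of_openAug_holds`
  (F-0413) — for EVERY hypothesis predicate `H` under which the (`TM`- resp. `TCG`-) models have open
  augmentation;
* `unitPairIsoFibres_tlg_openAug_holds` — the second (pre-erratum, `TLG` two-lift) conjunct of F-0412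
  `UnitPairIsoFibres` for all `TLG`-pairs with open augmentation (the first conjunct is abc-iut-L6-t21's
  unconditional `unitPairIso_isoM_eq`).

HONEST FRAMING: an INSTANCE form of the frozen facts (FACT-LIST rule R5), not the closed form F-0412 over
all typed pairs (that one is equivalent to a Nikolov–Segal-type statement, p428794); OUR kernel check of
classical plumbing; nothing here bears on [IUTchIII] Cor. 3.12 or asserts anything about abc.
-/

noncomputable section

open scoped nonZeroDivisors

namespace Literature.AnabelianGeometry.AbsoluteAnabelian

/-! ### §1. Open augmentation is a property of the `TLG` pair -/

section Model

variable {C₁ C₂ : MLFClosure.{0}} (D₁ : ModelMLFGaloisData C₁.k C₁.K) (D₂ : ModelMLFGaloisData C₂.k C₂.K)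

/-- The abstract Galois isomorphism covered by an ISOMORPHISM OF MODEL `TLG`-PAIRS is continuous: the
object component `k̄₁^× ⥲ k̄₂^×` is equivariant along it (`continuous_galoisMulEquiv_of_equivariant`).
[cite: MochizukiAbsTopIII2015, Definition 3.1 (ii) p.67] -/
private theorem continuous_galoisMulEquiv_of_tlgPair_iso (ι : GaloisMonoidPair.Iso D₁.tlgPair D₂.tlgPair)
    (α : (C₁.K ≃ₐ[C₁.k] C₁.K) ≃* (C₂.K ≃ₐ[C₂.k] C₂.K)) (hα : ∀ g, α (D₁.aug g) = D₂.aug (ι.isoPi g)) :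
    Continuous α := by
  refine continuous_galoisMulEquiv_of_equivariant C₁ C₂ α ι.isoM fun σ x y hxy => ?_
  obtain ⟨g, rfl⟩ := D₁.aug_surjective σ
  have hxy' : y = (g : D₁.tlgPair.Pi) • x := Subtype.ext hxy
  have h1 := ι.smul_comm (g : D₁.tlgPair.Pi) x
  rw [← hxy'] at h1
  have h2 := congrArg (fun z : D₂.tlgPair.M => ((z : (C₂.K)⁰) : C₂.K)) h1
  have h3 : (((ι.isoPi g : D₂.tlgPair.Pi) • ι.isoM x : D₂.tlgPair.M) : C₂.K) =
      α (D₁.aug g) ((ι.isoM x : (C₂.K)⁰) : C₂.K) := by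
    show D₂.aug (ι.isoPi g) • ((ι.isoM x : (C₂.K)⁰) : C₂.K) = _
    rw [← hα]
    rfl
  exact h2.trans h3

/-- Same for the inverse isomorphism. [cite: MochizukiAbsTopIII2015, Definition 3.1 (ii) p.67] -/
private theorem continuous_galoisMulEquiv_symm_of_tlgPair_iso
    (ι : GaloisMonoidPair.Iso D₁.tlgPair D₂.tlgPair)
    (α : (C₁.K ≃ₐ[C₁.k] C₁.K) ≃* (C₂.K ≃ₐ[C₂.k] C₂.K)) (hα : ∀ g, α (D₁.aug g) = D₂.aug (ι.isoPi g)) :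
    Continuous α.symm := by
  have hαs : ∀ h, α.symm (D₂.aug h) = D₁.aug (ι.isoPi.symm h) := fun h => by
    rw [MulEquiv.symm_apply_eq, hα, ContinuousMulEquiv.apply_symm_apply]
  refine continuous_galoisMulEquiv_of_equivariant C₂ C₁ α.symm ι.isoM.symm fun τ x y hxy => ?_
  obtain ⟨h, rfl⟩ := D₂.aug_surjective τ
  have hxy' : y = (h : D₂.tlgPair.Pi) • x := Subtype.ext hxy
  have h1 := ι.symm_smul_comm (h : D₂.tlgPair.Pi) x
  rw [← hxy'] at h1
  have h2 := congrArg (fun z : D₁.tlgPair.M => ((z : (C₁.K)⁰) : C₁.K)) h1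
  have h3 : (((ι.isoPi.symm h : D₁.tlgPair.Pi) • ι.isoM.symm x : D₁.tlgPair.M) : C₁.K) =
      α.symm (D₂.aug h) ((ι.isoM.symm x : (C₁.K)⁰) : C₁.K) := by
    show D₁.aug (ι.isoPi.symm h) • ((ι.isoM.symm x : (C₁.K)⁰) : C₁.K) = _
    rw [hαs]
    rfl
  exact h2.trans h3

/-- **Open augmentation is a property of the `TLG` PAIR**: if two model `TLG`-pairs are isomorphic and one
augmentation `ε₁ : Π₁ ↠ Gal(k̄₁/k₁)` is an open map, so is the other (`ε₂ = α ∘ ε₁ ∘ f⁻¹` with `α` the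
covered Galois isomorphism, a homeomorphism by the two lemmas above).
[cite: MochizukiAbsTopIII2015, Definition 3.1 (i) p.66] -/
theorem ModelMLFGaloisData.isOpenMap_aug_of_tlgPair_iso (ι : GaloisMonoidPair.Iso D₁.tlgPair D₂.tlgPair)
    (h₁ : IsOpenMap D₁.aug) : IsOpenMap D₂.aug := by
  have hf : D₁.aug.ker.map ι.isoPi.toMulEquiv.toMonoidHom = D₂.aug.ker := by
    rw [← ModelMLFGaloisData.tlgPair_actionKer C₁ D₁, ← ModelMLFGaloisData.tlgPair_actionKer C₂ D₂]
    exact ι.map_actionKer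
  obtain ⟨α, hα⟩ := ModelMLFGaloisData.exists_galoisMulEquiv_of_map_ker_eq D₁ D₂ ι.isoPi hf
  let α' : (C₁.K ≃ₐ[C₁.k] C₁.K) ≃ₜ* (C₂.K ≃ₐ[C₂.k] C₂.K) :=
    { α with
      continuous_toFun := continuous_galoisMulEquiv_of_tlgPair_iso D₁ D₂ ι α hα
      continuous_invFun := continuous_galoisMulEquiv_symm_of_tlgPair_iso D₁ D₂ ι α hα }
  have heq : (D₂.aug : D₂.Pi → (C₂.K ≃ₐ[C₂.k] C₂.K)) = α' ∘ D₁.aug ∘ ι.isoPi.symm := by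
    funext h
    show D₂.aug h = α (D₁.aug (ι.isoPi.symm h))
    rw [hα, ContinuousMulEquiv.apply_symm_apply]
  rw [heq]
  exact α'.toHomeomorph.isOpenMap.comp (h₁.comp ι.isoPi.symm.toHomeomorph.isOpenMap)

end Model

/-! ### §2. The lifting sentences for pairs with open augmentation, unconditionally -/

/-- **`TLG` lifting for pairs with OPEN augmentation, UNCONDITIONALLY**: if the MLF-Galois `TLG`-pairs
`P`, `Q` admit models whose augmentations are open maps (print: "the quotient `Π_k ↠ G_k`"), every
admissible isomorphism of topological groups `Π ⥲ Π*` lifts to an isomorphism of pairs.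
[cite: MochizukiAbsTopIII2015, Proposition 3.3 (ii) p.74] -/
theorem tlgLifting_openAug_holds (P Q : GaloisMonoidPair.{0}) (hP : IsMLFGaloisMonoidPair .TLG P)
    (hQ : IsMLFGaloisMonoidPair .TLG Q)
    (hPo : ∀ (C : MLFClosure.{0}) (D : ModelMLFGaloisData C.k C.K),
      Nonempty (GaloisMonoidPair.Iso D.tlgPair P) → IsOpenMap D.aug)
    (hQo : ∀ (C : MLFClosure.{0}) (D : ModelMLFGaloisData C.k C.K),
      Nonempty (GaloisMonoidPair.Iso D.tlgPair Q) → IsOpenMap D.aug)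
    (f : P.Pi ≃ₜ* Q.Pi) (hf : P.actionKer.map f.toMulEquiv.toMonoidHom = Q.actionKer) :
    ∃ e : GaloisMonoidPair.Iso P Q, e.isoPi = f := by
  obtain ⟨C₁, D₁, P₁, hP₁, ⟨ι₁⟩⟩ := hP.exists_model
  obtain ⟨C₂, D₂, Q₂, hQ₂, ⟨ι₂⟩⟩ := hQ.exists_model
  rw [ModelMLFGaloisData.monoidPair_TLG, Option.some.injEq] at hP₁ hQ₂
  subst hP₁
  subst hQ₂
  have hε₁ : IsOpenMap D₁.aug := hPo C₁ D₁ ⟨ι₁⟩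
  have hε₂ : IsOpenMap D₂.aug := hQo C₂ D₂ ⟨ι₂⟩
  set f' : D₁.Pi ≃ₜ* D₂.Pi := ι₁.isoPi.trans (f.trans ι₂.isoPi.symm) with hf'
  have hf'k : D₁.aug.ker.map f'.toMulEquiv.toMonoidHom = D₂.aug.ker := by
    have hcomp : f'.toMulEquiv.toMonoidHom = ι₂.isoPi.symm.toMulEquiv.toMonoidHom.comp
        (f.toMulEquiv.toMonoidHom.comp ι₁.isoPi.toMulEquiv.toMonoidHom) := MonoidHom.ext fun _ => rfl
    rw [← ModelMLFGaloisData.tlgPair_actionKer C₁ D₁, ← ModelMLFGaloisData.tlgPair_actionKer C₂ D₂, hcomp,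
      ← Subgroup.map_map, ← Subgroup.map_map, ι₁.map_actionKer, hf, ι₂.symm_map_actionKer]
  obtain ⟨α, hα⟩ :=
    ModelMLFGaloisData.exists_galoisContinuousMulEquiv_of_isOpenMap D₁ D₂ hε₁ hε₂ f' hf'k
  obtain ⟨β, hβ⟩ := biAnabelianUnits_holds C₁ C₂ α
  obtain ⟨e₁, he₁⟩ :=
    ModelMLFGaloisData.exists_tlgPair_iso_of_equivariant D₁ D₂ f' α.toMulEquiv hα β hβ
  refine ⟨⟨f, ι₁.isoM.symm.trans (e₁.isoM.trans ι₂.isoM), fun g x => ?_⟩, rfl⟩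
  show ι₂.isoM (e₁.isoM (ι₁.isoM.symm (g • x))) = f g • ι₂.isoM (e₁.isoM (ι₁.isoM.symm x))
  rw [GaloisMonoidPair.Iso.symm_smul_comm, e₁.smul_comm, ι₂.smul_comm, he₁]
  show ι₂.isoPi (ι₂.isoPi.symm (f (ι₁.isoPi (ι₁.isoPi.symm g)))) • _ = _
  rw [ContinuousMulEquiv.apply_symm_apply, ContinuousMulEquiv.apply_symm_apply]

/-- Transfer of "open augmentation" from a `TM`-model of a pair to all `TLG`-models of its `TLG`-pair.
[cite: MochizukiAbsTopIII2015, Definition 3.1 (ii) p.67] -/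
private theorem openAug_tlgPair_of_tmPair_iso (C : MLFClosure.{0}) (D : ModelMLFGaloisData C.k C.K)
    (h : IsOpenMap D.aug) :
    ∀ (C' : MLFClosure.{0}) (D' : ModelMLFGaloisData C'.k C'.K),
      Nonempty (GaloisMonoidPair.Iso D'.tlgPair D.tlgPair) → IsOpenMap D'.aug := by
  rintro C' D' ⟨ι⟩
  -- `ι : D'.tlgPair ≅ D.tlgPair`; transfer openness from `D` to `D'` along the inverse direction
  have hf : D.aug.ker.map ι.isoPi.symm.toMulEquiv.toMonoidHom = D'.aug.ker := by
    rw [← ModelMLFGaloisData.tlgPair_actionKer C D, ← ModelMLFGaloisData.tlgPair_actionKer C' D']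
    exact ι.symm_map_actionKer
  obtain ⟨α, hα⟩ := ModelMLFGaloisData.exists_galoisMulEquiv_of_map_ker_eq D D' ι.isoPi.symm hf
  -- `α.symm` is covered by `ι`, hence continuous in both directions by §1
  have hα' : ∀ g, α.symm (D'.aug g) = D.aug (ι.isoPi g) := fun g => by
    rw [MulEquiv.symm_apply_eq, hα, ContinuousMulEquiv.symm_apply_apply]
  have hc1 : Continuous α.symm := continuous_galoisMulEquiv_of_tlgPair_iso D' D ι α.symm hα'
  have hc2 : Continuous α.symm.symm := continuous_galoisMulEquiv_symm_of_tlgPair_iso D' D ι α.symm hα'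
  let α' : (C.K ≃ₐ[C.k] C.K) ≃ₜ* (C'.K ≃ₐ[C'.k] C'.K) :=
    { α with
      continuous_toFun := by simpa using hc2
      continuous_invFun := hc1 }
  have heq : (D'.aug : D'.Pi → (C'.K ≃ₐ[C'.k] C'.K)) = α' ∘ D.aug ∘ ι.isoPi := by
    funext g
    show D'.aug g = α (D.aug (ι.isoPi g))
    rw [← hα', MulEquiv.apply_symm_apply]
  rw [heq]
  exact α'.toHomeomorph.isOpenMap.comp (h.comp ι.isoPi.toHomeomorph.isOpenMap)

/-- **F-0409 `GaloisIsoLiftsToTMPairIso H` UNCONDITIONALLY for every hypothesis predicate `H` under which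
the `TM`-models have OPEN augmentation** ([AbsTopIII] Prop. 3.2 (iv), author's corrected form; the
intended étale / tempered instances are of this kind). [cite: MochizukiAbsTopIII2015, Proposition 3.2 (iv) p.72]
[cite: MochizukiAbsTopIIIComments2019, item (5)] -/
theorem galoisIsoLiftsToTMPairIso_of_openAug_holds (H : GaloisMonoidPair.{0} → Prop)
    (hH : ∀ P, H P → ∀ (C : MLFClosure.{0}) (D : ModelMLFGaloisData C.k C.K),
      Nonempty (GaloisMonoidPair.Iso D.tmPair P) → IsOpenMap D.aug) :
    Literature.AnabelianGeometry.AbsoluteAnabelian.GaloisIsoLiftsToTMPairIso H :=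
  galoisIsoLiftsToTMPairIso_of_tlgLifting_relative H
    (fun P => ∀ (C : MLFClosure.{0}) (D : ModelMLFGaloisData C.k C.K),
      Nonempty (GaloisMonoidPair.Iso D.tlgPair P) → IsOpenMap D.aug)
    (fun C D P hι hHP => openAug_tlgPair_of_tmPair_iso C D (hH P hHP C D hι))
    (fun P Q hP hQ hPo hQo f hf => tlgLifting_openAug_holds P Q hP hQ hPo hQo f hf)

/-- **`TCG` lifting UNCONDITIONALLY under open-augmentation hypothesis predicates** ([AbsTopIII] Prop.
3.3 (ii)). [cite: MochizukiAbsTopIII2015, Proposition 3.3 (ii) p.74] -/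
theorem tcgLifting_openAug_holds (H : GaloisMonoidPair.{0} → Prop)
    (hH : ∀ P, H P → ∀ (C : MLFClosure.{0}) (D : ModelMLFGaloisData C.k C.K),
      Nonempty (GaloisMonoidPair.Iso D.tcgPair P) → IsOpenMap D.aug)
    (P Q : GaloisMonoidPair.{0}) (hP : IsMLFGaloisMonoidPair .TCG P) (hQ : IsMLFGaloisMonoidPair .TCG Q)
    (hHP : H P) (hHQ : H Q) (f : P.Pi ≃ₜ* Q.Pi)
    (hf : P.actionKer.map f.toMulEquiv.toMonoidHom = Q.actionKer) :
    ∃ e : GaloisMonoidPair.Iso P Q, e.isoPi = f :=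
  tcgLifting_of_tlgLifting_relative H
    (fun P => ∀ (C : MLFClosure.{0}) (D : ModelMLFGaloisData C.k C.K),
      Nonempty (GaloisMonoidPair.Iso D.tlgPair P) → IsOpenMap D.aug)
    (fun C D P hι hHP => openAug_tlgPair_of_tmPair_iso C D (hH P hHP C D hι))
    (fun P Q hP hQ hPo hQo f hf => tlgLifting_openAug_holds P Q hP hQ hPo hQo f hf)
    P Q hP hQ hHP hHQ f hf

/-- **F-0413 `UnitPairIsoFibresOfType H` UNCONDITIONALLY under open-augmentation hypothesis predicates**
([AbsTopIII] Prop. 3.3 (ii) as corrected, both clauses). [cite: MochizukiAbsTopIII2015, Proposition 3.3 (ii) p.74]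
[cite: MochizukiAbsTopIIIComments2019, item (5)] -/
theorem unitPairIsoFibresOfType_of_openAug_holds (H : GaloisMonoidPair.{0} → Prop)
    (hH : ∀ P, H P → ∀ (C : MLFClosure.{0}) (D : ModelMLFGaloisData C.k C.K),
      Nonempty (GaloisMonoidPair.Iso D.tcgPair P) → IsOpenMap D.aug)
    (hH' : ∀ P, H P → ∀ (C : MLFClosure.{0}) (D : ModelMLFGaloisData C.k C.K),
      Nonempty (GaloisMonoidPair.Iso D.tlgPair P) → IsOpenMap D.aug) :
    Literature.AnabelianGeometry.AbsoluteAnabelian.UnitPairIsoFibresOfType H :=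
  unitPairIsoFibresOfType_of_tlgLifting_relative H
    (fun P => ∀ (C : MLFClosure.{0}) (D : ModelMLFGaloisData C.k C.K),
      Nonempty (GaloisMonoidPair.Iso D.tlgPair P) → IsOpenMap D.aug)
    (fun C D P hι hHP => openAug_tlgPair_of_tmPair_iso C D (hH P hHP C D hι))
    (fun P Q hP hQ hPo hQo f hf => tlgLifting_openAug_holds P Q hP hQ hPo hQo f hf)
    (fun P Q hP hQ hHP hHQ f hf =>
      unitPairIso_fibre_two_of_exists_lift P Q hP f
        (tlgLifting_openAug_holds P Q hP hQ (hH' P hHP) (hH' Q hHQ) f hf))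

/-- **The `TLG` two-lift conjunct of F-0412 `UnitPairIsoFibres` for pairs with open augmentation,
UNCONDITIONALLY** (pre-erratum Prop. 3.3 (ii), `TLG`: over every admissible `Π ⥲ Π*` there are exactly
two isomorphisms of pairs). [cite: MochizukiAbsTopIII2015, Proposition 3.3 (ii) p.74] -/
theorem unitPairIsoFibres_tlg_openAug_holds (P Q : GaloisMonoidPair.{0}) (hP : IsMLFGaloisMonoidPair .TLG P)
    (hQ : IsMLFGaloisMonoidPair .TLG Q)
    (hPo : ∀ (C : MLFClosure.{0}) (D : ModelMLFGaloisData C.k C.K),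
      Nonempty (GaloisMonoidPair.Iso D.tlgPair P) → IsOpenMap D.aug)
    (hQo : ∀ (C : MLFClosure.{0}) (D : ModelMLFGaloisData C.k C.K),
      Nonempty (GaloisMonoidPair.Iso D.tlgPair Q) → IsOpenMap D.aug)
    (f : P.Pi ≃ₜ* Q.Pi) (hf : P.actionKer.map f.toMulEquiv.toMonoidHom = Q.actionKer) :
    ∃ e₁ e₂ : GaloisMonoidPair.Iso P Q, e₁.isoPi = f ∧ e₂.isoPi = f ∧ e₁.isoM ≠ e₂.isoM ∧
      ∀ e : GaloisMonoidPair.Iso P Q, e.isoPi = f → (e.isoM = e₁.isoM ∨ e.isoM = e₂.isoM) :=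
  unitPairIso_fibre_two_of_exists_lift P Q hP f (tlgLifting_openAug_holds P Q hP hQ hPo hQo f hf)

end Literature.AnabelianGeometry.AbsoluteAnabelian

end
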